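import Summits.BirchSwinnertonDyer.BirchSwinnertonDyer.Theorems.QuadraticBranchSignedControlPlusEtaNonsurjLambdaTransferPeriod
import Summits.BirchSwinnertonDyer.Rank1Residual.Additive.SignedTwistOddBranchReadings
import Summits.BirchSwinnertonDyer.Rank1Residual.Additive.ChiEigenPrimeToPDescentGenerator
import Summits.BirchSwinnertonDyer.Rank1Residual.Additive.CyclotomicTowerSignedSelmerDual
import Literature.NumberTheory.EllipticCurves.KatoRankBoundProofs
import HarnessLib

/-!
# Route `QuadraticBranchSignedControl` (rung K8, cell `bsd-potss`), residual crux `PlusEtaMainConjectureNonsurj`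
# (stmt-BirchSwinnertonDyer-19606): Part XLIX — THE OTHER v7-ERA BINDER TOO: `CorpuzLei2025_etaPlusMainConjecture_transfer_OPEN`
# (the anchor's `μ = 0` read ALGEBRAICALLY — the hypothesis `hCL` of k8eta-c2 g8's 30 unit-anchor records `…CMAnchorTransferRecords` A–E)
# follows from the `anMu` form, hence from the same named facts (seat `bsd-potss-k8eta-c2` g33)

WHY. g8 typed the Corpuz–Lei composite in two readings of the anchor's `μ = 0`: ANALYTIC (`…_anMu_OPEN`, proved in Parts XLVI/XLVIII from cite
facts) and ALGEBRAIC (`…_OPEN`: every characteristic generator of every `η`-datum of `V′` has unit content). GIVEN the main conjecture at `V′`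
(a hypothesis of both binders), the two readings agree: for any `(f′, ϖ′, Lη′)` pick ONE frame — `K₀ = ℚ(μ_p)` with THE quadratic character
(`SignedTwist.exists_theta_eta_cyclotomicField`), a cyclotomic `κ` with a topological generator matching the variable
(`exists_isCyclotomic_isTopGenerator_isCyclotomicVariable_holds`) moved into `Gal(ℚ̄/K₀)` (`kappa_surjOn_galRange_cyclotomic`,
`SignedTwist.isCyclotomicVariable_of_inv_mul_mem_ker`), an `η`-datum (`nonempty_etaSignedSelmerDualData_cyclotomic`) — read `Char = (Lη′)` there
and apply the algebraic hypothesis to the generator `Lη′`. So §143: `…_OPEN` ⟸ `…_anMu_OPEN`; §144: `…_OPEN` from the named facts of Part XLVIII.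
After this file BOTH binders of the v7 era are theorems modulo cite-level facts, and every one of g8's 30 per-row transfer records (both forms) is
binder-free by substitution.

HONEST FRAMING (cell `bsd-potss`; FULL-BSD rank ≤ 1 programme, HUMAN RULING D-0036/D-0074): BOOKKEEPING THEOREMS ONLY — no definition, no named
fact minted, no `sorry`, axioms standard; CONDITIONAL on the displayed named facts. No stub of 19606 is closed; the crux and the route stay OPEN;
nothing is booked; `BSD(W, p)` is claimed for no pair. `--supports stmt-BirchSwinnertonDyer-19606`.

References: [CorpuzLei2025] Thms 5.3, 5.9, 5.10; [HatleyLei2019] Thm. 4.6, Prop. 5.1; [Kobayashi2003] Def. 2.1, Thm. 2.2, §3 (the frame), §4, Thm. 4.1;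
[GreenbergVatsal2000] p. 2 (1)–(2), §3 Rem. 3.4.
-/

set_option autoImplicit false
set_option linter.dupNamespace false
noncomputable section

open scoped Classical

open CongruenceSubgroup Field NumberField IsDedekindDomain WeierstrassCurve
open Literature.NumberTheory.EllipticCurves
open Literature.NumberTheory.EllipticCurves.ModularForms
open Literature.NumberTheory.GaloisRepresentations
open Literature.NumberTheory.EllipticCurves.IwasawaAlgebra
open Literature.NumberTheory.EllipticCurves.GreenbergVatsal2000
open ZpExtension
open Summit.BirchSwinnertonDyer.Rank1Residual.Additive

namespace Summit.BirchSwinnertonDyer.BirchSwinnertonDyer.Theorems.EtaLambdaTransfer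

/-! ## §143 The algebraic-`μ` binder from the analytic-`μ` binder -/

/-- **`CorpuzLei2025_etaPlusMainConjecture_transfer_OPEN` ⟸ `CorpuzLei2025_etaPlusMainConjecture_transfer_anMu_OPEN`.** Given the even main
conjecture at `η` for the anchor `V′` and unit content of EVERY characteristic generator of EVERY `η`-datum of `V′` (the algebraic reading), the
analytic reading follows: for any newform/period/branch-function triple `(f′, ϖ′, Lη′)` of `V′`, in ONE frame (which exists: `ℚ(μ_p)` with its
quadratic character, a cyclotomic `κ` with a topological generator in `Gal(ℚ̄/ℚ(μ_p))` matching the variable, an `η`-datum) the main conjecture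
reads `Char = (Lη′)`, so `Lη′` is a characteristic generator and has unit content. Pure bookkeeping between the two g8 binders.
[claim: CorpuzLei2025, status: under-review] [cite: Kobayashi2003, Def. 2.1 (p. 5), §3 (p. 5), §4 Even main conjecture (p. 8)]
[cite: GreenbergVatsal2000, p. 2 (1)–(2)] -/
theorem corpuzLei2025_etaPlusMainConjecture_transfer_of_anMu (h : CorpuzLei2025_etaPlusMainConjecture_transfer_anMu_OPEN) :
    CorpuzLei2025_etaPlusMainConjecture_transfer_OPEN := by
  intro V V' _ _ _ _ p hp hp2 hgood hap hgood' hap' hcong hMC' hμalg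
  refine h V V' p hp2 hgood hap hgood' hap' hcong hMC' ?_
  intro N' _ f' hf' ϖ' hϖ' Lη' hL'
  -- one frame: `K₀ = ℚ(μ_p)`, THE quadratic character `ηθ`, a cyclotomic `κ`, a generator `γ' ∈ Gal(ℚ̄/K₀)` matching the variable
  haveI : NeZero p := ⟨hp.out.ne_zero⟩
  haveI : IsCyclotomicExtension {p} ℚ (CyclotomicField p ℚ) := CyclotomicField.isCyclotomicExtension p ℚ
  haveI : (galRange (K := ℚ) (CyclotomicField p ℚ)).Normal := normal_galRange_cyclotomic p _
  obtain ⟨θ, ηθ, -, -, -, hηK, hη1⟩ := SignedTwist.exists_theta_eta_cyclotomicField p hp2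
  obtain ⟨κ, hκ, γ, hγ, hγc⟩ := exists_isCyclotomic_isTopGenerator_isCyclotomicVariable_holds p
  obtain ⟨γ', hγ'K, hγ'κ⟩ := kappa_surjOn_galRange_cyclotomic κ (CyclotomicField p ℚ) (κ γ)
  have hγγ' : γ⁻¹ * γ' ∈ κ.kerSubgroup := by
    rw [ZpExtension.mem_kerSubgroup, map_mul, map_inv, hγ'κ, inv_mul_cancel]
  have hγ' : κ.IsTopGenerator γ' := by rw [ZpExtension.IsTopGenerator, hγ'κ]; exact hγ
  have hγ'c : IsCyclotomicVariable p γ' := SignedTwist.isCyclotomicVariable_of_inv_mul_mem_ker hκ hγγ' hγc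
  obtain ⟨D'⟩ := nonempty_etaSignedSelmerDualData_cyclotomic V' κ (CyclotomicField p ℚ) ℚ_[p] ηθ 1 hγ' hγ'K
  -- the main conjecture at `V′` in that frame: `Char(D′.X) = (Lη′)`; the algebraic hypothesis on the generator `Lη′`
  obtain ⟨-, -, hchar⟩ := hMC' (CyclotomicField p ℚ) ηθ hηK hη1 hp2 hgood' hap' hf' ϖ' hϖ' Lη' hL' κ γ' hκ hγ' hγ'K hγ'c D'
  exact hμalg (CyclotomicField p ℚ) ηθ hηK hη1 κ γ' hκ hγ' hγ'K D' Lη' hchar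

/-! ## §144 The algebraic-`μ` binder from named facts only -/

/-- **`CorpuzLei2025_etaPlusMainConjecture_transfer_OPEN` FROM NAMED FACTS ONLY** — the hypothesis `hCL` of k8eta-c2 g8's unit-anchor transfer
records (`EtaCMAnchorTransferRecords`, parts A–E, 30 rows): Hatley–Lei Thm. 4.6 + Prop. 5.1 (`h46`), Corpuz–Lei Thm. 5.3 (`h53`), Kobayashi
Thm. 2.2η (`h22`) and 4.1η (`h41`), modularity (`hnf`), Greenberg–Vatsal's period comparison in both parities (`hGV`, `hGVm`) — §143 ∘ Part XLVIII
§141. CONDITIONAL on these cite-level facts; the binder's statement is unchanged; nothing booked. [claim: CorpuzLei2025, status: under-review]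
[cite: HatleyLei2019, Thm. 4.6, Prop. 5.1] [cite: Kobayashi2003, Thm. 2.2 (p. 5), Thm. 4.1 (p. 8)] [cite: GreenbergVatsal2000, p. 4 and §3 Remark 3.4] -/
theorem corpuzLei2025_etaPlusMainConjecture_transfer_of_citeFacts
    (h46 : HatleyLei2019.thm46_prop51_etaSignedMuLambda_transfer_of_torsionIso)
    (h53 : CorpuzLei2025.thm53_etaPlusAnalyticMuLambda_transfer_of_torsionIso)
    (h22 : Kobayashi2003.thm22_etaSignedSelmerDual_finite_torsion)
    (h41 : Kobayashi2003.thm41_plusEtaCharIdeal_dvd)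
    (hnf : exists_isNewformOf) (hGV : realPeriodRat_eq_unit_mul_plusPeriod)
    (hGVm : numRealComponents_mul_imaginaryPeriodRat_eq_unit_mul_minusPeriod_of_odd) :
    CorpuzLei2025_etaPlusMainConjecture_transfer_OPEN :=
  corpuzLei2025_etaPlusMainConjecture_transfer_of_anMu
    (corpuzLei2025_etaPlusMainConjecture_transfer_anMu_of_citeFacts h46 h53 h22 h41 hnf hGV hGVm)

end Summit.BirchSwinnertonDyer.BirchSwinnertonDyer.Theorems.EtaLambdaTransfer

end
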